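import Mathlib
import Literature.MathematicalPhysics.QuantumFieldTheory.Balaban1983to89.B5RealFields

/-! # `Balaban1983to89.B5GaussSectC` — the Gaussian integrals of B5 Sect. C: (1.24), (1.27)/(1.28) = (1.39),
p. 25 l. 1, (1.40), the limit (1.41) with the `δ_R` display of p. 25, and (1.46), kernel-checked as
finite-dimensional measure theory (GAPS rows G-adv4-10, C-adv4-34; unit b2b-balaban-b05-g13, node 3)

CITATION HEADER. T. Bałaban, *Propagators and renormalization transformations for lattice gauge theories. I*,
Commun. Math. Phys. 95 (1984) 17–40 [`Balaban1984PropagatorsI`], Sect. C "Change of gauge", pp. 21–26 [PDF 5–10]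
(renders `…/1984-cmp95-propagators-rt-I-p005-x2.png`, `-p006-x2.png`, `-p008-x2.png`, `-p009-x2.png`,
`-p010-x2.png`, read as images). Cell pub-balaban, paper sub-cell B05. It closes the items listed as NOT typed in
`B5Infimum124` («The Gaussian integral (1.24) itself and (1.27)/(1.28) (no integration is typed)») and in
`B5Projector144` («NOT HERE: (1.24)–(1.28), (1.39)–(1.41), δ_R»), and binds the `δ_R` display of G-adv4-10
(«Typers: no tree module binds the δ_R display today»).

WHAT IS PRINTED.  p. 21 [PDF 5]: «Now we will calculate the integral inside the above expression:
∫dλδ(Q′_kλ)exp(−(1/2α)⟨∂*A^λ, ∂*A^λ⟩) = ∫dλδ(Q′_kλ)exp(−(1/2α)‖∂*∂λ‖²)·exp(−(1/α) inf_{λ:Q′_kλ=0} ½‖∂*A − ∂*∂λ‖²),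
(1.24) and the infimum can be calculated using Lagrange multipliers.» (∂*A^λ = ∂*A − Δλ, Δ = ∂*∂.)  p. 22 [PDF 6]:
«and the infimum in (1.24) is acquired at the function λ₀ = … The value of the infimum is equal to ½‖∂*A − Δλ₀‖² =
… (1.26) where we have used the fact that the quadratic form in ∂*A is defined by a projection operator. We have
finally exp(−(1/2α)⟨∂*A, ∂*A⟩)(∫dλδ(Q′_kλ)exp(−(1/2α)⟨∂*A^λ, ∂*A^λ⟩))⁻¹ = (∫dλδ(Q′_kλ)exp(−(1/2α)‖Δλ‖²))⁻¹
exp[−(1/2α)⟨∂*A, (I − Δ⁻¹Q′*_k(Q′_kΔ⁻²Q′*_k)⁻¹Q′_kΔ⁻¹)∂*A⟩]. (1.27) It is easy to verify that the operator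
I − Δ⁻¹Q′*_k(Q′_kΔ⁻²Q′*_k)⁻¹Q′_kΔ⁻¹ is a projection in the space L²(T_η) of scalar functions, so we can write also
(1.27) = (∫dλδ(Q′_kλ)exp(−(1/2α)‖Δλ‖²))⁻¹ · exp[−(1/2α)‖(I − Δ⁻¹Q′*_k(Q′_kΔ⁻²Q′*_k)⁻¹Q′_kΔ⁻¹)∂*A‖²]. (1.28)»
p. 24 [PDF 8]: «Let us denote the projection operator by R … The gauge fixing density has the form
𝒢_α(∂*A) = (∫dλδ(Q′_kλ)exp(−(1/2α)‖Δλ‖²))⁻¹ exp(−(1/2α)‖R∂*A‖²), (1.39)»  p. 25 [PDF 9]: «and from its definition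
it follows that ∫dλδ(Q′_kλ)𝒢_α(∂*A^λ) = 1. The projection operator R has a clear meaning. It is an orthogonal
projection on the linear subspace ΔN(Q′_k) of L²(T_η), N(Q′_k) = {λ : Q′_kλ = 0}. … Let us denote this subspace by R
also, R = ΔN(Q′_k). We have ∫dλδ(Q′_kλ)exp(−(1/2α)‖Δλ‖²) = ∫_{N(Q′_k)}dλ exp(−(1/2α)‖Δλ‖²)
= |det(Δ⁻¹↾_R)| ∫_R dλ exp(−(1/2α)‖λ‖²), (1.40) so the density 𝒢_α has a limit as α → 0
𝒢_α(∂*A) ⟶_{α→0} |det(Δ↾_{N(Q′_k)})| δ_R(∂*A), (1.41) where δ_R is a δ-function concentrated at the origin of the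
sub-space R. By definition ∫dλδ_R(λ)f(λ) = ∫dλδ_R(Rλ)f(λ) = ∫_R dλ₂ ∫_R dλ₁ δ_R(λ₁)f(λ₁ + λ₂) = ∫_R dλ₂ f(λ₂). Let
us recall also that the operator Δ is positive definite on N(Q′_k), thus invertible, as it follows from [2].» (sic:
the subscript R under the two λ₂-integrals — GAPS G-adv4-10, settled below: they range over R^⊥.)  p. 26 [PDF 10]:
«In the sequel it will be convenient to take the limit α → 0, i.e. to consider Landau gauge. We may introduce this
gauge from the beginning using the equation ∫dλδ(Q′_kλ)|det(Δ↾_{N(Q′_k)})|δ_R(∂*A − Δλ) = 1. (1.46)»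

TYPING (abstract, §§1–6; the torus instance §7).  `E` — a finite-dimensional real inner-product space with its
Lebesgue (`volume`) measure — is `L²(T_η)` (real scalar functions); `N : Submodule ℝ E` is `N(Q′_k)`;
`Δ : E →ₗ[ℝ] E`; the one printed input used is `Set.InjOn Δ N` («Δ is positive definite on N(Q′_k), thus invertible»:
Δ is injective on N(Q′_k)) — a HYPOTHESIS of §§2–6, DISCHARGED in §7 (`injOn_torus`) for the typed torus
Laplacian `B5Action121.LapS` and block average `B5Block118.QsOp` acting on real fields.  `Rsub N Δ = ΔN` is the
subspace R; the OPERATOR R is typed as `Rop N Δ := (Rsub N Δ).starProjection`, the orthogonal projection onto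
ΔN(Q′_k) — i.e. by the sentence of p. 25 ll. 2–5, NOT by the formula (1.38)/(1.44) (their identification —
`R144_fix_iff_exists`, `R144_symm`, `R144_idem`, `R138_eq_R144_of_orth` — is `B5Projector144`, by name; not
imported).  `γ_α(v) = gaussW E α v := exp(−‖v‖²/2α)`.  THE CONSTRAINT MEASURE `δ(Q′_kλ)dλ` is typed as the Lebesgue
measure of the subspace N(Q′_k) (`∫ x : N, …` w.r.t. `volume` of the inner-product space `↥N`): this is the first
equality of (1.40) taken as a definition (DIVERGENCE: a constant Jacobian of Q′_k is thereby dropped — Bałaban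
never evaluates it; it cancels in (1.27) = (1.39) and in p. 25 l. 1, while the first equality of (1.40), (1.41)
and (1.46) «= 1» hold EXACTLY under the Lebesgue normalisation adopted here for BOTH the measure and |det| — the
one the print's own (1.40)/(1.47) use; v1.1, XREAD C-adv9-115 D-1).
`|det(Δ↾_{N(Q′_k)})|` is `detN N Δ := (Δ.domRestrict N).normDet` (Mathlib's `LinearMap.normDet`: |det| of a map
between different inner-product spaces in orthonormal bases — exactly the Jacobian of p. 25, «well defined as a map
between different subspaces of equal dimension», C-adv4-34), and |det(Δ⁻¹↾_R)| = (detN N Δ)⁻¹ (`ZN_eq`).  (1.41)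
is typed as a limit of distributions: against every continuous compactly supported test function, along `𝓝[>] 0`.

WHAT THIS FILE CERTIFIES (kernel, no `sorry`, axioms standard; value = referee-grade reproduction of the Sect. C
Gaussian bookkeeping + G-adv4-10 settled by computation, NOT summit progress).
1. §1 `Zg_eq`: ∫_V exp(−‖v‖²/2α)dv = (2πα)^{dim V/2} (α > 0), scaling `Zg_eq_pow_mul_Zg_one`.
2. §2 the change of variables (1.40): `integral_comp_Delta` ∫_{N(Q′_k)} φ(Δλ)dλ = |det(Δ↾N(Q′_k))|⁻¹ ∫_R φ(μ)dμ for
   EVERY φ : E → F (from `Set.InjOn Δ N`; `detN_pos`; via `LinearMap.normDet` and `map_linearMap_addHaar_eq_smul_addHaar`);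
   `ZN_eq`/`ZN_eq_rpow`: (1.40) verbatim, Z_N(α) = |det(Δ↾N)|⁻¹(2πα)^{dim R/2}.
3. §3 (1.24): `gaussW_sub_Delta_split` (Pythagoras ‖∂*A − Δλ‖² = ‖(I−R)∂*A‖² + ‖R∂*A − Δλ‖² on N(Q′_k)), `iInf_124`
   (inf_{N(Q′_k)}‖∂*A − Δλ‖² = ‖(I − R)∂*A‖², attained: (1.26)), `integral_124`:
   ∫_{N(Q′_k)} γ_α(∂*A − Δλ)dλ = Z_N(α)·exp(−(1/2α) inf …) — (1.24) with both factors identified (translation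
   invariance on N(Q′_k), `integral_gaussW_Rop_sub_Delta`).
4. §4 (1.39) `calG`; `calG_eq_127`: the left side of (1.27) equals 𝒢_α(∂*A) ((1.27) = (1.28) = (1.39) with R the
   orthogonal projection onto ΔN(Q′_k)); `integral_calG_sub_Delta`: p. 25 l. 1 «∫dλδ(Q′_kλ)𝒢_α(∂*A^λ) = 1» for
   every ∂*A and α > 0; `calG_eq_detN_mul`: 𝒢_α = |det(Δ↾N(Q′_k))|·δ_R^α with δ_R^α(f) = Z_R(α)⁻¹γ_α(Rf) (`nasc`).
5. §5 (1.46): `integral_146` ∫_{N(Q′_k)} |det(Δ↾N(Q′_k))| φ(R(∂*A − Δλ)) dλ = ∫_R φ for EVERY φ : E → F — so (1.46)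
   holds for any Lebesgue-normalised regularisation φ of δ_R (in particular `integral_146_gauss`, φ = δ_R^α), which
   is the precise content of «we may introduce this gauge from the beginning using the equation (1.46)».
6. §6 (1.41) AND THE δ_R DISPLAY, COMPUTED (`tendsto_integral_nasc`, `tendsto_integral_calG`): for every
   f ∈ C_c(L²(T_η)),  ∫ 𝒢_α(λ)f(λ)dλ ⟶_{α→0⁺} |det(Δ↾_{N(Q′_k)})| ∫_{R^⊥} f(λ₂)dλ₂.  The proof IS the printed chain:
   `nasc_starProjection` (δ_R^α(λ) = δ_R^α(Rλ)), Fubini along L²(T_η) = R ⊕ R^⊥ (`integral_eq_integral_prod`,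
   `measurePreserving_splitEquiv`), the inner limit on R `tendsto_inner` (∫_R δ_R^α(λ₁)f(λ₁ + λ₂)dλ₁ → f(λ₂):
   scaling λ₁ = √α·u and dominated convergence), then dominated convergence on R^⊥ (compact support).  The kernel
   thus fixes the reading of G-adv4-10: the two λ₂-integrals of the display range over the ORTHOGONAL COMPLEMENT
   R^⊥ = (ΔN(Q′_k))^⊥, λ₁ = Rλ ∈ R — with the printed subscripts (λ₂ ∈ R) the right-hand side would be ∫_R f, which
   is not the limit.  `deltaK K f := ∫_{K^⊥} f`.
7. §7 THE TORUS MODEL: `L2T n M = EuclideanSpace ℝ (Tor (fine n M))`, `DeltaT` = `reM (LapS (fine n M) c)`,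
   `NQ` = ker `reM (QsOp n M)`; `injOn_torus` (c ≠ 0): Q′_kλ = 0 ∧ Δλ = 0 ⟹ λ = 0, from
   `B5LaplaceSpectral.LapS_ker_const` (Δλ = 0 ⟹ λ constant) and `B5Substitution125.QsOp_const` (Q′_k c = c),
   through the real/complex bridge `B5RealFields.isReal_LapS/isReal_QsOp/IsReal.cplx_mulVec`; hence
   `integral_calG_sub_Delta_torus`, `tendsto_integral_calG_torus`, `integral_146_torus` with NO hypothesis left.

WHAT IS NOT CERTIFIED HERE. (a) R = the printed operators (1.38)/(1.44): see `B5Projector144` (on ∂*A-type fields,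
⊥ constants, both agree with the orthogonal projection onto ΔN(Q′_k) typed here). (b) The Jacobian constant of
`δ(Q′_kλ)dλ` relative to Lebesgue measure on N(Q′_k) (dropped by the typing above; never printed). (c) (1.42)–(1.45)
(`B5Projector144`, `B5Sandwich145`), the momentum formulas (1.29)–(1.37) (`B5Momentum130/133`, `B5FiberQuadratic`),
and Sect. D from (1.47) on (`B5Lagrange149Torus`, `B5Hk160Torus`, …). (d) Vector-valued (gauge-field) measures dA:
only the scalar gauge-parameter integrals dλ of Sect. C are in scope.

TAGS: [cite: Balaban1984PropagatorsI, …] on transcribed formulas; untagged lemmas are [folklore] finite-dimensional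
Gaussian calculus. -/

noncomputable section

open MeasureTheory Module Filter Topology
open scoped InnerProductSpace ENNReal

namespace Literature.MathematicalPhysics.QuantumFieldTheory.Balaban1983to89.B5GaussSectC

/-! ## §1 The Gaussian profile `γ_α(v) = exp(−‖v‖²/2α)` and `Z_V(α) = ∫_V γ_α = (2πα)^{dim V/2}` -/

section GaussDef

variable (V : Type*) [NormedAddCommGroup V]

/-- `γ_α(v) = exp(−(1/2α)‖v‖²)` — the Gaussian profile appearing in (1.24), (1.39), (1.40).
[cite: Balaban1984PropagatorsI, (1.24) p.21] -/
def gaussW (α : ℝ) (v : V) : ℝ := Real.exp (-‖v‖ ^ 2 / (2 * α))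

variable {V}

/-- `γ_α > 0`. [folklore] -/
theorem gaussW_pos (α : ℝ) (v : V) : 0 < gaussW V α v := Real.exp_pos _

/-- `γ_α ≤ 1` for `α ≥ 0`. [folklore] -/
theorem gaussW_le_one {α : ℝ} (hα : 0 ≤ α) (v : V) : gaussW V α v ≤ 1 := by
  unfold gaussW
  rw [Real.exp_le_one_iff, neg_div]
  have : 0 ≤ ‖v‖ ^ 2 / (2 * α) := by positivity
  linarith

/-- `|γ_α| ≤ 1` for `α ≥ 0`. [folklore] -/
theorem abs_gaussW_le_one {α : ℝ} (hα : 0 ≤ α) (v : V) : |gaussW V α v| ≤ 1 := by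
  rw [abs_of_pos (gaussW_pos α v)]; exact gaussW_le_one hα v

/-- `γ_α(0) = 1`. [folklore] -/
@[simp] theorem gaussW_zero (α : ℝ) : gaussW V α 0 = 1 := by simp [gaussW]

/-- `γ_α(−v) = γ_α(v)`. [folklore] -/
theorem gaussW_neg (α : ℝ) (v : V) : gaussW V α (-v) = gaussW V α v := by simp [gaussW]

/-- `γ_α(u − v) = γ_α(v − u)`. [folklore] -/
theorem gaussW_sub_comm (α : ℝ) (v w : V) : gaussW V α (v - w) = gaussW V α (w - v) := by
  rw [← gaussW_neg, neg_sub]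

/-- `γ_α` is continuous. [folklore] -/
theorem continuous_gaussW (α : ℝ) : Continuous (gaussW V α) := by
  unfold gaussW; fun_prop

/-- `γ_α(v) = exp(−(2α)⁻¹‖v‖²)` (the shape of Mathlib's Gaussian integral). [folklore] -/
theorem gaussW_eq_exp_mul (α : ℝ) (v : V) :
    gaussW V α v = Real.exp (-(2 * α)⁻¹ * ‖v‖ ^ 2) := by
  unfold gaussW; congr 1; ring

end GaussDef

section GaussIP

variable {V : Type*} [NormedAddCommGroup V] [InnerProductSpace ℝ V]

/-- `γ_α(u + w) = γ_α(u) γ_α(w)` for `⟪u, w⟫ = 0` (Pythagoras). [folklore] -/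
theorem gaussW_add_of_inner_eq_zero (α : ℝ) {u w : V} (h : ⟪u, w⟫_ℝ = 0) :
    gaussW V α (u + w) = gaussW V α u * gaussW V α w := by
  unfold gaussW
  rw [← Real.exp_add]
  congr 1
  have := norm_add_sq_eq_norm_sq_add_norm_sq_of_inner_eq_zero u w h
  rw [← sq, ← sq, ← sq] at this
  rw [this]; ring

/-- the scaling `v = √α u`: `γ_α(√α u) = γ_1(u)`. [folklore] -/
theorem gaussW_sqrt_smul {α : ℝ} (hα : 0 < α) (u : V) :
    gaussW V α (Real.sqrt α • u) = gaussW V 1 u := by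
  unfold gaussW
  rw [norm_smul, Real.norm_of_nonneg (Real.sqrt_nonneg α), mul_pow, Real.sq_sqrt hα.le]
  congr 1
  field_simp

end GaussIP

section GaussInt

variable (V : Type*) [NormedAddCommGroup V] [InnerProductSpace ℝ V] [FiniteDimensional ℝ V]
  [MeasurableSpace V] [BorelSpace V]

/-- `Z_V(α) = ∫_V exp(−‖v‖²/2α) dv` (Lebesgue measure of the inner product). [folklore] -/
def Zg (α : ℝ) : ℝ := ∫ v : V, gaussW V α v

/-- `Z_V(α) = (2πα)^{dim V/2}` (Mathlib's Gaussian integral on an inner product space). [folklore] -/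
theorem Zg_eq {α : ℝ} (hα : 0 < α) : Zg V α = (2 * Real.pi * α) ^ (finrank ℝ V / 2 : ℝ) := by
  unfold Zg
  simp_rw [gaussW_eq_exp_mul]
  rw [GaussianFourier.integral_rexp_neg_mul_sq_norm (by positivity : 0 < (2 * α)⁻¹)]
  congr 1
  rw [div_inv_eq_mul]; ring

/-- `Z_V(α) > 0` for `α > 0`. [folklore] -/
theorem Zg_pos {α : ℝ} (hα : 0 < α) : 0 < Zg V α := by
  rw [Zg_eq V hα]; positivity

/-- `γ_α` is integrable on a finite-dimensional inner-product space (`α > 0`). [folklore] -/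
theorem integrable_gaussW {α : ℝ} (hα : 0 < α) : Integrable (gaussW V α) := by
  by_contra h
  exact (Zg_pos V hα).ne' (integral_undef h)

/-- scaling: `Z_V(α) = (√α)^{dim V} · Z_V(1)`. [folklore] -/
theorem Zg_eq_pow_mul_Zg_one {α : ℝ} (hα : 0 < α) :
    Zg V α = Real.sqrt α ^ finrank ℝ V * Zg V 1 := by
  have h1 : Zg V 1 = ∫ u : V, gaussW V α (Real.sqrt α • u) := by
    unfold Zg; simp_rw [gaussW_sqrt_smul hα]
  rw [h1, Measure.integral_comp_smul volume (gaussW V α) (Real.sqrt α), smul_eq_mul, abs_inv,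
    abs_of_pos (pow_pos (Real.sqrt_pos.mpr hα) _), ← mul_assoc,
    mul_inv_cancel₀ (pow_pos (Real.sqrt_pos.mpr hα) _).ne', one_mul, Zg]

end GaussInt

/-! ## §2 The setting of Sect. C: `N = N(Q′_k)`, `Δ`, `R = ΔN(Q′_k)`, the operator `R`,
`|det(Δ↾_{N(Q′_k)})|`, and the change of variables (1.40) -/

section Alg

variable {E : Type*} [NormedAddCommGroup E] [InnerProductSpace ℝ E]
variable (N : Submodule ℝ E) (Δ : E →ₗ[ℝ] E)

/-- The subspace `R = ΔN(Q′_k)` of `L²(T_η)` (p. 25: «Let us denote this subspace by R also»).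
[cite: Balaban1984PropagatorsI, p.25] -/
def Rsub : Submodule ℝ E := LinearMap.range (Δ.domRestrict N)

/-- `μ ∈ R ⟺ μ = Δλ` for some `λ ∈ N(Q′_k)`. [folklore] -/
theorem mem_Rsub {y : E} : y ∈ Rsub N Δ ↔ ∃ x ∈ N, Δ x = y := by
  simp only [Rsub, LinearMap.mem_range, LinearMap.domRestrict_apply, Subtype.exists, exists_prop]

/-- `Δλ ∈ R` for `λ ∈ N(Q′_k)`. [folklore] -/
theorem Delta_mem_Rsub {x : E} (hx : x ∈ N) : Δ x ∈ Rsub N Δ := (mem_Rsub N Δ).2 ⟨x, hx, rfl⟩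

omit N Δ in
/-- `γ_α` of a vector of a subspace, computed in the subspace. [folklore] -/
theorem gaussW_coe (K : Submodule ℝ E) (α : ℝ) (y : K) : gaussW E α (y : E) = gaussW K α y := rfl

/-- `Δ↾_{N(Q′_k)} : N(Q′_k) → R` as a map onto its range. [cite: Balaban1984PropagatorsI, (1.40)/(1.41) p.25] -/
def Tmap : N →ₗ[ℝ] Rsub N Δ := (Δ.domRestrict N).rangeRestrict

/-- `Δ↾_{N(Q′_k)}` acts as `Δ`. [folklore] -/
@[simp] theorem coe_Tmap (x : N) : (Tmap N Δ x : E) = Δ x := rfl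

/-- `Δ↾_{N(Q′_k)} : N(Q′_k) → R` is onto (definition of `R = ΔN(Q′_k)`). [folklore] -/
theorem Tmap_surjective : Function.Surjective (Tmap N Δ) := LinearMap.surjective_rangeRestrict _

/-- p. 25: «the operator Δ is positive definite on N(Q′_k), thus invertible» — what is used below: `Δ` is
injective on `N(Q′_k)` (Mathlib's `Set.InjOn Δ N`), equivalently `λ ∈ N(Q′_k), Δλ = 0 ⟹ λ = 0`.
[cite: Balaban1984PropagatorsI, p.25] -/
theorem injOn_iff : Set.InjOn Δ N ↔ ∀ x ∈ N, Δ x = 0 → x = 0 := by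
  constructor
  · intro h x hx hx0
    exact h hx N.zero_mem (by rw [hx0, map_zero])
  · intro h x hx y hy hxy
    exact sub_eq_zero.1 (h (x - y) (N.sub_mem hx hy) (by rw [map_sub, hxy, sub_self]))

variable {N Δ}

/-- under `Set.InjOn Δ N`: `ker(Δ↾_{N(Q′_k)}) = 0`. [folklore] -/
theorem ker_eq_bot (h : Set.InjOn Δ N) : LinearMap.ker (Δ.domRestrict N) = ⊥ := by
  rw [LinearMap.ker_eq_bot']
  intro x hx
  exact Subtype.ext ((injOn_iff N Δ).1 h x x.2 hx)

/-- under `Set.InjOn Δ N`: `Δ↾_{N(Q′_k)} : N(Q′_k) → R` is injective. [folklore] -/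
theorem Tmap_injective (h : Set.InjOn Δ N) : Function.Injective (Tmap N Δ) := by
  intro x y hxy
  have hE : Δ (x : E) = Δ y := by simpa using congrArg Subtype.val hxy
  have hker := LinearMap.ker_eq_bot.1 (ker_eq_bot h)
  exact hker (by simpa using hE)

/-- `Δ↾N` as a linear equivalence `N(Q′_k) ≃ R`. [folklore] -/
def Tequiv (h : Set.InjOn Δ N) : N ≃ₗ[ℝ] Rsub N Δ :=
  LinearEquiv.ofBijective (Tmap N Δ) ⟨Tmap_injective h, Tmap_surjective N Δ⟩

/-- the bijection `N(Q′_k) ≃ R` acts as `Δ`. [folklore] -/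
@[simp] theorem coe_Tequiv (h : Set.InjOn Δ N) (x : N) : (Tequiv h x : E) = Δ x := rfl

/-- `Δ((Δ↾_{N(Q′_k)})⁻¹μ) = μ` for `μ ∈ R`. [folklore] -/
theorem Delta_Tequiv_symm (h : Set.InjOn Δ N) (y : Rsub N Δ) : Δ ((Tequiv h).symm y : E) = y :=
  congrArg Subtype.val ((Tequiv h).apply_symm_apply y)

/-- `dim N(Q′_k) = dim R` (p. 25: a map «between different subspaces of equal dimension»). [folklore] -/
theorem finrank_eq (h : Set.InjOn Δ N) : finrank ℝ N = finrank ℝ (Rsub N Δ) :=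
  (LinearMap.finrank_range_of_inj (LinearMap.ker_eq_bot.1 (ker_eq_bot h))).symm

end Alg

section FinDim

variable {E : Type*} [NormedAddCommGroup E] [InnerProductSpace ℝ E] [FiniteDimensional ℝ E]
variable (N : Submodule ℝ E) (Δ : E →ₗ[ℝ] E)

/-- The operator `R` := the orthogonal projection of `L²(T_η)` onto `ΔN(Q′_k)` (p. 25 ll. 2–5:
«It is an orthogonal projection on the linear subspace ΔN(Q′_k) of L²(T_η)»).
[cite: Balaban1984PropagatorsI, p.25 ll.2-5] -/
def Rop : E →L[ℝ] E := (Rsub N Δ).starProjection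

/-- `Rλ ∈ R`. [folklore] -/
theorem Rop_apply_mem (v : E) : Rop N Δ v ∈ Rsub N Δ := by
  rw [Rop, Submodule.starProjection_apply]; exact SetLike.coe_mem _

/-- `Rω = ω ⟺ ω ∈ R = ΔN(Q′_k)` (p. 25 ll. 3–5, for the orthogonal projection).
[cite: Balaban1984PropagatorsI, p.25] -/
theorem Rop_eq_self_iff {v : E} : Rop N Δ v = v ↔ v ∈ Rsub N Δ :=
  Submodule.starProjection_eq_self_iff

/-- «RΔλ = Δλ if Q′_kλ = 0». [cite: Balaban1984PropagatorsI, p.25] -/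
theorem Rop_Delta {x : E} (hx : x ∈ N) : Rop N Δ (Δ x) = Δ x :=
  (Rop_eq_self_iff N Δ).2 (Delta_mem_Rsub N Δ hx)

/-- `λ − Rλ ∈ R^⊥`. [folklore] -/
theorem sub_Rop_mem_orthogonal (v : E) : v - Rop N Δ v ∈ (Rsub N Δ)ᗮ :=
  Submodule.sub_starProjection_mem_orthogonal v

/-- `R∂*A ∈ ΔN(Q′_k)`: `R f = Δλ₀` for some `λ₀ ∈ N(Q′_k)` (the minimiser of (1.24), p. 22).
[cite: Balaban1984PropagatorsI, p.22] -/
theorem exists_lambda0 (f : E) : ∃ x ∈ N, Δ x = Rop N Δ f :=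
  (mem_Rsub N Δ).1 (Rop_apply_mem N Δ f)

/-- The exponent split behind (1.24) (abstract twin of `B5Infimum124.norm_split`):
`γ_α(f − Δλ) = γ_α(f − Rf) · γ_α(Rf − Δλ)` for `λ ∈ N(Q′_k)` (Pythagoras: `f − Rf ⊥ R ∋ Rf − Δλ`).
[cite: Balaban1984PropagatorsI, (1.24) p.21] -/
theorem gaussW_sub_Delta_split (α : ℝ) (f : E) {x : E} (hx : x ∈ N) :
    gaussW E α (f - Δ x) = gaussW E α (f - Rop N Δ f) * gaussW E α (Rop N Δ f - Δ x) := by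
  have hsum : f - Δ x = (f - Rop N Δ f) + (Rop N Δ f - Δ x) := by abel
  rw [hsum]
  exact gaussW_add_of_inner_eq_zero α (Submodule.inner_left_of_mem_orthogonal
    (Submodule.sub_mem _ (Rop_apply_mem N Δ f) (Delta_mem_Rsub N Δ hx)) (sub_Rop_mem_orthogonal N Δ f))

/-- «the infimum in (1.24)»: `‖f − Rf‖ ≤ ‖f − Δλ‖` for every `λ ∈ N(Q′_k)`, with equality at `λ₀`
(`Δλ₀ = Rf`, `exists_lambda0`) — `inf_{λ : Q′_kλ = 0} ½‖∂*A − Δλ‖² = ½‖(1 − R)∂*A‖²`, cf. (1.26).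
[cite: Balaban1984PropagatorsI, (1.24) p.21, (1.26) p.22] -/
theorem norm_sub_Rop_le (f : E) {x : E} (hx : x ∈ N) : ‖f - Rop N Δ f‖ ≤ ‖f - Δ x‖ := by
  have hsum : f - Δ x = (f - Rop N Δ f) + (Rop N Δ f - Δ x) := by abel
  have horth : ⟪f - Rop N Δ f, Rop N Δ f - Δ x⟫_ℝ = 0 := Submodule.inner_left_of_mem_orthogonal
    (Submodule.sub_mem _ (Rop_apply_mem N Δ f) (Delta_mem_Rsub N Δ hx)) (sub_Rop_mem_orthogonal N Δ f)
  have hpy := norm_add_sq_eq_norm_sq_add_norm_sq_of_inner_eq_zero _ _ horth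
  rw [← hsum] at hpy
  refine le_of_pow_le_pow_left₀ two_ne_zero (norm_nonneg _) ?_
  nlinarith [hpy, mul_self_nonneg ‖Rop N Δ f - Δ x‖]

/-- the infimum of (1.24): `inf_{λ : Q′_kλ = 0} ‖∂*A − Δλ‖² = ‖(I − R)∂*A‖²`, attained at a `λ₀` with
`Δλ₀ = R∂*A` ((1.26); abstract twin of `B5Infimum124.infimum_124`).
[cite: Balaban1984PropagatorsI, (1.24)/(1.26) pp.21-22] -/
theorem iInf_124 (f : E) : ⨅ x : N, ‖f - Δ (x : E)‖ ^ 2 = ‖f - Rop N Δ f‖ ^ 2 := by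
  obtain ⟨x₀, hx₀, h0⟩ := exists_lambda0 N Δ f
  apply le_antisymm
  · refine ciInf_le_of_le ⟨0, ?_⟩ ⟨x₀, hx₀⟩ (by rw [Submodule.coe_mk, h0])
    rintro _ ⟨x, rfl⟩; positivity
  · exact le_ciInf fun x => pow_le_pow_left₀ (norm_nonneg _) (norm_sub_Rop_le N Δ f x.2) 2

/-- `R² = R`. [folklore] -/
theorem Rop_Rop (f : E) : Rop N Δ (Rop N Δ f) = Rop N Δ f :=
  (Rop_eq_self_iff N Δ).2 (Rop_apply_mem N Δ f)

/-- `|det(Δ↾_{N(Q′_k)})|` := the volume Jacobian of `Δ↾N : N(Q′_k) → L²(T_η)` (Mathlib's norm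
determinant: `|det|` of the matrix in any orthonormal bases of `N(Q′_k)` and `R = ΔN(Q′_k)`).
[cite: Balaban1984PropagatorsI, (1.41) p.25] -/
def detN : ℝ := (Δ.domRestrict N).normDet

/-- `|det(Δ↾_{N(Q′_k)})| ≥ 0`. [folklore] -/
theorem detN_nonneg : 0 ≤ detN N Δ := LinearMap.normDet_nonneg _

/-- `|det(Δ↾_{N(Q′_k)})|` computed on the range-restricted map `N(Q′_k) → R`. [folklore] -/
theorem detN_eq_normDet_Tmap : detN N Δ = (Tmap N Δ).normDet :=
  (LinearMap.normDet_codRestrict _).symm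

variable {N Δ}

/-- under `Set.InjOn Δ N`: `|det(Δ↾_{N(Q′_k)})| > 0` («thus invertible»). [folklore] -/
theorem detN_pos (h : Set.InjOn Δ N) : 0 < detN N Δ := by
  refine lt_of_le_of_ne (detN_nonneg N Δ) fun h0 => ?_
  exact (LinearMap.normDet_eq_zero_iff_ker_ne_bot.1 h0.symm) (ker_eq_bot h)

/-- an auxiliary linear isometry `N(Q′_k) ≃ R` (equal dimensions). [folklore] -/
def isoNR (h : Set.InjOn Δ N) : N ≃ₗᵢ[ℝ] Rsub N Δ :=
  (stdOrthonormalBasis ℝ N).equiv (stdOrthonormalBasis ℝ (Rsub N Δ)) (finCongr (finrank_eq h))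

/-- the endomorphism `ι⁻¹ ∘ Δ↾N` of `N(Q′_k)` (`ι` the auxiliary isometry). [folklore] -/
def Smap (h : Set.InjOn Δ N) : N →ₗ[ℝ] N :=
  (isoNR h).symm.toLinearEquiv.toLinearMap ∘ₗ Tmap N Δ

/-- `isoNR ∘ Smap = Δ↾_{N(Q′_k)}`. [folklore] -/
theorem isoNR_Smap (h : Set.InjOn Δ N) (x : N) : isoNR h (Smap h x) = Tmap N Δ x := by
  simp [Smap]

/-- `|det Smap| = |det(Δ↾_{N(Q′_k)})|` (a linear isometry has `normDet = 1`). [folklore] -/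
theorem abs_det_Smap (h : Set.InjOn Δ N) : |LinearMap.det (Smap h)| = detN N Δ := by
  rw [← LinearMap.normDet_eq_abs_det, Smap,
    LinearMap.normDet_comp_of_finrank_eq _ _ (finrank_eq h), detN_eq_normDet_Tmap]
  have : ((isoNR h).symm.toLinearEquiv.toLinearMap).normDet = 1 :=
    (isoNR h).symm.toLinearIsometry.normDet_eq_one
  rw [this, one_mul]

/-- under `Set.InjOn Δ N`: `det Smap ≠ 0`. [folklore] -/
theorem det_Smap_ne_zero (h : Set.InjOn Δ N) : LinearMap.det (Smap h) ≠ 0 := by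
  intro h0
  have := abs_det_Smap h
  rw [h0, abs_zero] at this
  exact (detN_pos h).ne this

end FinDim

section CoV

variable {E : Type*} [NormedAddCommGroup E] [InnerProductSpace ℝ E] [FiniteDimensional ℝ E]
  [MeasurableSpace E] [BorelSpace E]
variable {N : Submodule ℝ E} {Δ : E →ₗ[ℝ] E}

/-- (1.40), the change of variables `λ ↦ Δλ` from `N(Q′_k)` onto `R`:
`∫_{N(Q′_k)} φ(Δλ) dλ = |det(Δ↾_{N(Q′_k)})|⁻¹ · ∫_R φ(μ) dμ` (paper: `|det(Δ⁻¹↾_R)| ∫_R …`).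
[cite: Balaban1984PropagatorsI, (1.40) p.25] -/
theorem integral_comp_Delta (h : Set.InjOn Δ N) {F : Type*} [NormedAddCommGroup F] [NormedSpace ℝ F]
    (φ : E → F) : ∫ x : N, φ (Δ x) = (detN N Δ)⁻¹ • ∫ y : Rsub N Δ, φ y := by
  have hdet := det_Smap_ne_zero h
  let eS : N ≃ᵐ N :=
    ((LinearMap.equivOfDetNeZero (Smap h) hdet).toContinuousLinearEquiv).toHomeomorph.toMeasurableEquiv
  have heS : ∀ x : N, eS x = Smap h x := fun x => rfl
  have h1 : (fun x : N => φ (Δ x)) = fun x : N => (fun z : N => φ (isoNR h z)) (eS x) := by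
    funext x
    simp only [heS, isoNR_Smap, coe_Tmap]
  have h2 : Measure.map (Smap h) volume = Measure.map eS volume := by
    congr 1
  have h3 : ∫ x : N, φ (Δ x) = ∫ z : N, φ (isoNR h z) ∂(Measure.map (Smap h) volume) := by
    rw [h1, h2]
    exact (integral_map_equiv eS (fun z : N => φ (isoNR h z))).symm
  rw [h3, Measure.map_linearMap_addHaar_eq_smul_addHaar volume hdet, integral_smul_measure,
    ENNReal.toReal_ofReal (abs_nonneg _), abs_inv, abs_det_Smap h]
  congr 1
  exact (isoNR h).measurePreserving.integral_comp (isoNR h).toHomeomorph.measurableEmbedding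
    (fun y : Rsub N Δ => φ y)

/-- (1.40) read from `R`: `∫_R φ(μ) dμ = |det(Δ↾_{N(Q′_k)})| ∫_{N(Q′_k)} φ(Δλ) dλ`. [folklore] -/
theorem integral_Rsub_eq (h : Set.InjOn Δ N) {F : Type*} [NormedAddCommGroup F] [NormedSpace ℝ F]
    (φ : E → F) : ∫ y : Rsub N Δ, φ y = detN N Δ • ∫ x : N, φ (Δ x) := by
  rw [integral_comp_Delta h, smul_smul, mul_inv_cancel₀ (detN_pos h).ne', one_smul]


/-! ## §3 (1.24) and the normalising integral `Z_N(α) = ∫dλ δ(Q′_kλ) exp(−(1/2α)‖Δλ‖²)` -/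

variable (N Δ) in
/-- `Z_N(α) = ∫dλ δ(Q′_kλ) exp(−(1/2α)‖Δλ‖²) := ∫_{N(Q′_k)} γ_α(Δλ) dλ` — the first equality of (1.40)
(«∫dλ δ(Q′_kλ) exp(−‖Δλ‖²/2α) = ∫_{N(Q′_k)} dλ exp(−‖Δλ‖²/2α)») is taken as the TYPING of the
constraint measure `δ(Q′_kλ)dλ`: the Lebesgue measure of the subspace `N(Q′_k)`.
[cite: Balaban1984PropagatorsI, (1.40) p.25] -/
def ZN (α : ℝ) : ℝ := ∫ x : N, gaussW E α (Δ x)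

/-- (1.40), second equality: `Z_N(α) = |det(Δ⁻¹↾_R)| ∫_R exp(−‖λ‖²/2α) dλ = |det(Δ↾N(Q′_k))|⁻¹ Z_R(α)`.
[cite: Balaban1984PropagatorsI, (1.40) p.25] -/
theorem ZN_eq (h : Set.InjOn Δ N) (α : ℝ) : ZN N Δ α = (detN N Δ)⁻¹ * Zg (Rsub N Δ) α := by
  unfold ZN Zg
  rw [integral_comp_Delta h (gaussW E α), smul_eq_mul]
  rfl

/-- `Z_N(α) = |det(Δ↾N(Q′_k))|⁻¹ (2πα)^{dim R/2}`. [cite: Balaban1984PropagatorsI, (1.40) p.25] -/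
theorem ZN_eq_rpow (h : Set.InjOn Δ N) {α : ℝ} (hα : 0 < α) :
    ZN N Δ α = (detN N Δ)⁻¹ * (2 * Real.pi * α) ^ (finrank ℝ (Rsub N Δ) / 2 : ℝ) := by
  rw [ZN_eq h, Zg_eq _ hα]

/-- `Z_N(α) > 0`. [folklore] -/
theorem ZN_pos (h : Set.InjOn Δ N) {α : ℝ} (hα : 0 < α) : 0 < ZN N Δ α := by
  rw [ZN_eq h]; exact mul_pos (inv_pos.2 (detN_pos h)) (Zg_pos _ hα)

/-- `∫_{N(Q′_k)} γ_α(Rf − Δλ) dλ = Z_N(α)`: the translation `λ → λ₀ + λ` on `N(Q′_k)`, admissible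
since `λ₀ ∈ N(Q′_k)` (invariance of the Lebesgue measure of `N(Q′_k)`).
[cite: Balaban1984PropagatorsI, (1.24) p.21] -/
theorem integral_gaussW_Rop_sub_Delta (α : ℝ) (f : E) :
    ∫ x : N, gaussW E α (Rop N Δ f - Δ x) = ZN N Δ α := by
  obtain ⟨x₀, hx₀, hΔx₀⟩ := exists_lambda0 N Δ f
  have hfun : (fun x : N => gaussW E α (Rop N Δ f - Δ x)) =
      fun x : N => (fun z : N => gaussW E α (Δ z)) (x - ⟨x₀, hx₀⟩) := by
    funext x
    simp only [Submodule.coe_sub, map_sub]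
    rw [← hΔx₀, gaussW_sub_comm]
  rw [hfun]
  exact integral_sub_right_eq_self (μ := (volume : Measure N)) (fun z : N => gaussW E α (Δ z)) ⟨x₀, hx₀⟩

/-- (1.24), evaluated: `∫dλ δ(Q′_kλ) exp(−(1/2α)‖∂*A − Δλ‖²) = Z_N(α) · exp(−(1/2α)‖∂*A − R∂*A‖²)`,
the second factor being `exp(−(1/α) inf_{λ:Q′_kλ=0} ½‖∂*A − Δλ‖²)` by `norm_sub_Rop_le`.
[cite: Balaban1984PropagatorsI, (1.24) p.21] -/
theorem integral_124 (α : ℝ) (f : E) :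
    ∫ x : N, gaussW E α (f - Δ x) = ZN N Δ α * gaussW E α (f - Rop N Δ f) := by
  have hfun : (fun x : N => gaussW E α (f - Δ x)) =
      fun x : N => gaussW E α (f - Rop N Δ f) * gaussW E α (Rop N Δ f - Δ x) := by
    funext x; exact gaussW_sub_Delta_split N Δ α f x.2
  rw [hfun, integral_const_mul, integral_gaussW_Rop_sub_Delta, mul_comm]

/-! ## §4 (1.39) = (1.27)/(1.28): the gauge-fixing density `𝒢_α`, and p. 25 l. 1 -/

variable (N Δ) in
/-- (1.39): `𝒢_α(∂*A) = (∫dλ δ(Q′_kλ) exp(−(1/2α)‖Δλ‖²))⁻¹ exp(−(1/2α)‖R∂*A‖²) = Z_N(α)⁻¹ γ_α(Rf)`,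
`f = ∂*A`. [cite: Balaban1984PropagatorsI, (1.39) p.24, (1.28) p.22] -/
def calG (α : ℝ) (f : E) : ℝ := (ZN N Δ α)⁻¹ * gaussW E α (Rop N Δ f)

/-- `𝒢_α > 0`. [folklore] -/
theorem calG_pos (h : Set.InjOn Δ N) {α : ℝ} (hα : 0 < α) (f : E) : 0 < calG N Δ α f :=
  mul_pos (inv_pos.2 (ZN_pos h hα)) (gaussW_pos α _)

variable (N Δ) in
/-- `𝒢_α(Rf) = 𝒢_α(f)`: the density depends on `f` only through `Rf` (first equality of the `δ_R`
display, p. 25: «∫dλ δ_R(λ) f(λ) = ∫dλ δ_R(Rλ) f(λ)»). [cite: Balaban1984PropagatorsI, p.25] -/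
theorem calG_Rop (α : ℝ) (f : E) : calG N Δ α (Rop N Δ f) = calG N Δ α f := by
  unfold calG; rw [Rop_Rop]

/-- (1.27): `exp(−(1/2α)‖∂*A‖²) · (∫dλ δ(Q′_kλ) exp(−(1/2α)‖∂*A^λ‖²))⁻¹ = 𝒢_α(∂*A)` with
`∂*A^λ = ∂*A − Δλ` — the passage (1.23) → (1.27) → (1.28) («the quadratic form in ∂*A is defined by a
projection operator»: `‖f‖² − ‖(1 − R)f‖² = ‖Rf‖²`). [cite: Balaban1984PropagatorsI, (1.27) p.22] -/
theorem calG_eq_127 (h : Set.InjOn Δ N) {α : ℝ} (hα : 0 < α) (f : E) :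
    gaussW E α f * (∫ x : N, gaussW E α (f - Δ x))⁻¹ = calG N Δ α f := by
  rw [integral_124, calG]
  have hf : gaussW E α f = gaussW E α (Rop N Δ f) * gaussW E α (f - Rop N Δ f) := by
    conv_lhs => rw [show f = Rop N Δ f + (f - Rop N Δ f) by abel]
    exact gaussW_add_of_inner_eq_zero α
      (Submodule.inner_right_of_mem_orthogonal (Rop_apply_mem N Δ f) (sub_Rop_mem_orthogonal N Δ f))
  rw [hf]
  field_simp [(ZN_pos h hα).ne', (gaussW_pos α (f - Rop N Δ f)).ne']

/-- p. 25 l. 1: «from its definition it follows that ∫dλ δ(Q′_kλ) 𝒢_α(∂*A^λ) = 1», `∂*A^λ = ∂*A − Δλ`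
— for EVERY `α > 0` and every `f` (uses `RΔλ = Δλ` and the translation `λ → λ₀ + λ`).
[cite: Balaban1984PropagatorsI, p.25 l.1] -/
theorem integral_calG_sub_Delta (h : Set.InjOn Δ N) {α : ℝ} (hα : 0 < α) (f : E) :
    ∫ x : N, calG N Δ α (f - Δ x) = 1 := by
  unfold calG
  rw [integral_const_mul]
  have hfun : (fun x : N => gaussW E α (Rop N Δ (f - Δ x))) =
      fun x : N => gaussW E α (Rop N Δ f - Δ x) := by
    funext x; rw [map_sub, Rop_Delta N Δ x.2]
  rw [hfun, integral_gaussW_Rop_sub_Delta, inv_mul_cancel₀ (ZN_pos h hα).ne']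

/-- `𝒢_α(f) = |det(Δ↾N(Q′_k))| · Z_R(α)⁻¹ γ_α(Rf)` — the form in which (1.41) takes the limit
(`Z_R(α)⁻¹ γ_α(R·) → δ_R`). [cite: Balaban1984PropagatorsI, (1.40)–(1.41) p.25] -/
theorem calG_eq_detN_mul (h : Set.InjOn Δ N) (α : ℝ) (f : E) :
    calG N Δ α f = detN N Δ * ((Zg (Rsub N Δ) α)⁻¹ * gaussW E α (Rop N Δ f)) := by
  unfold calG
  rw [ZN_eq h, mul_inv, inv_inv, mul_assoc]

/-! ## §5 (1.46): «∫dλ δ(Q′_kλ) |det(Δ↾_{N(Q′_k)})| δ_R(∂*A − Δλ) = 1» -/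

/-- (1.46) at finite `α`: `∫dλ δ(Q′_kλ) |det(Δ↾N(Q′_k))| [Z_R(α)⁻¹ γ_α(R(∂*A − Δλ))] = 1` for every
`α > 0` — the bracket being the nascent `δ_R` of (1.41); (1.46) is its `α`-independent value.
[cite: Balaban1984PropagatorsI, (1.46) p.26] -/
theorem integral_146_gauss (h : Set.InjOn Δ N) {α : ℝ} (hα : 0 < α) (f : E) :
    ∫ x : N, detN N Δ * ((Zg (Rsub N Δ) α)⁻¹ * gaussW E α (Rop N Δ (f - Δ x))) = 1 := by
  simp_rw [← calG_eq_detN_mul h]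
  exact integral_calG_sub_Delta h hα f

/-- (1.46) for an ARBITRARY regularisation of `δ_R`: for every profile `φ` (any nascent δ-function on
`R`, or any function at all), `∫_{N(Q′_k)} |det(Δ↾N(Q′_k))| φ(R(∂*A − Δλ)) dλ = ∫_R φ(μ) dμ`,
independently of `A`; with `∫_R φ = 1` this is (1.46). The two ingredients: (1.40) and the invariance
of the Lebesgue measure of `R` under `μ → R∂*A − μ`. [cite: Balaban1984PropagatorsI, (1.46) p.26] -/
theorem integral_146 (h : Set.InjOn Δ N) {F : Type*} [NormedAddCommGroup F] [NormedSpace ℝ F]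
    (φ : E → F) (f : E) :
    ∫ x : N, detN N Δ • φ (Rop N Δ (f - Δ x)) = ∫ y : Rsub N Δ, φ y := by
  have hfun : (fun x : N => φ (Rop N Δ (f - Δ x))) = fun x : N => (fun v : E => φ (Rop N Δ f - v)) (Δ x) := by
    funext x; rw [map_sub, Rop_Delta N Δ x.2]
  have hcov := integral_comp_Delta h (fun v : E => φ (Rop N Δ f - v))
  rw [integral_smul, hfun, hcov, smul_smul, mul_inv_cancel₀ (detN_pos h).ne', one_smul]
  -- `∫_R φ(Rf − μ) dμ = ∫_R φ(μ) dμ`: reflection `μ → −μ` then translation by `Rf ∈ R`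
  have hrefl := Measure.integral_comp_smul (volume : Measure (Rsub N Δ))
    (fun y : Rsub N Δ => φ (Rop N Δ f + (y : E))) (-1)
  simp only [neg_one_smul, Submodule.coe_neg, ← sub_eq_add_neg] at hrefl
  rw [hrefl]
  have hd : |((-1 : ℝ) ^ finrank ℝ (Rsub N Δ))⁻¹| = 1 := by
    rw [abs_inv, abs_pow, abs_neg, abs_one, one_pow, inv_one]
  rw [hd, one_smul]
  have htr := integral_add_left_eq_self (μ := (volume : Measure (Rsub N Δ)))
    (fun y : Rsub N Δ => φ (y : E)) ⟨Rop N Δ f, Rop_apply_mem N Δ f⟩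
  simpa using htr

end CoV

/-! ## §6 (1.41) and the `δ_R` display of p. 25: the limit `α → 0` -/

section Delta

variable {E : Type*} [NormedAddCommGroup E] [InnerProductSpace ℝ E] [FiniteDimensional ℝ E]
  [MeasurableSpace E] [BorelSpace E]
variable (K : Submodule ℝ E)

/-- The nascent `δ_K`: `δ_K^α(λ) = Z_K(α)⁻¹ γ_α(P_K λ)`, `P_K` the orthogonal projection onto `K`; for
`K = R = ΔN(Q′_k)`, `𝒢_α = |det(Δ↾N(Q′_k))| δ_R^α` (`calG_eq_detN_mul`).
[cite: Balaban1984PropagatorsI, (1.39)/(1.41) pp.24-25] -/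
def nasc (α : ℝ) (v : E) : ℝ := (Zg K α)⁻¹ * gaussW E α (K.starProjection v)

/-- `δ_K(f) := ∫_{K^⊥} f(λ₂) dλ₂` — integration over the orthogonal complement (the functional the
nascent family converges to, `tendsto_integral_nasc`). [cite: Balaban1984PropagatorsI, p.25] -/
def deltaK (f : E → ℝ) : ℝ := ∫ y : Kᗮ, f y

/-- `L²(T_η) ≃ K × K^⊥`, `λ ↦ (P_K λ, P_{K^⊥} λ)` (inverse `(λ₁, λ₂) ↦ λ₁ + λ₂`), as a measurable
equivalence; it preserves Lebesgue measure (`measurePreserving_splitEquiv`). [folklore] -/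
def splitEquiv : E ≃ᵐ (K × Kᗮ) :=
  (K.orthogonalDecomposition.toHomeomorph.toMeasurableEquiv).trans
    (MeasurableEquiv.toLp 2 (K × Kᗮ)).symm

/-- `splitEquiv λ = (P_K λ, P_{K^⊥} λ)`. [folklore] -/
theorem splitEquiv_apply (v : E) :
    splitEquiv K v = (K.orthogonalProjectionOnto v, Kᗮ.orthogonalProjectionOnto v) := by
  ext <;> simp [splitEquiv]

/-- `P_K λ + P_{K^⊥} λ = λ`. [folklore] -/
theorem splitEquiv_add (v : E) : ((splitEquiv K v).1 : E) + (splitEquiv K v).2 = v := by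
  simp [splitEquiv_apply]

/-- the inverse of `splitEquiv` is `(λ₁, λ₂) ↦ λ₁ + λ₂`. [folklore] -/
theorem splitEquiv_symm_apply (p : K × Kᗮ) : (splitEquiv K).symm p = (p.1 : E) + p.2 := by
  conv_rhs => rw [← (splitEquiv K).apply_symm_apply p]
  exact (splitEquiv_add K _).symm

/-- `λ ↦ (P_K λ, P_{K^⊥} λ)` carries the Lebesgue measure of `E` to the product of the Lebesgue
measures of `K` and `K^⊥`. [folklore] -/
theorem measurePreserving_splitEquiv :
    MeasurePreserving (splitEquiv K) volume ((volume : Measure K).prod volume) := by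
  have h := (WithLp.volume_preserving_ofLp K Kᗮ).comp K.orthogonalDecomposition.measurePreserving
  have hcoe : (splitEquiv K : E → K × Kᗮ) = fun v => WithLp.ofLp (K.orthogonalDecomposition v) := by
    funext v; ext <;> simp [splitEquiv_apply]
  rw [hcoe]; exact h

/-- Fubini along `L²(T_η) = K ⊕ K^⊥`: `∫ g(λ) dλ = ∫_{K×K^⊥} g(λ₁ + λ₂) d(λ₁, λ₂)`. [folklore] -/
theorem integral_eq_integral_prod {F : Type*} [NormedAddCommGroup F] [NormedSpace ℝ F] (g : E → F) :
    ∫ v, g v = ∫ p : K × Kᗮ, g ((p.1 : E) + p.2) ∂((volume : Measure K).prod volume) := by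
  rw [← (measurePreserving_splitEquiv K).integral_comp' (fun p : K × Kᗮ => g ((p.1 : E) + p.2))]
  simp only [splitEquiv_add]

/-- integrability transfers along `E ≃ K × K^⊥`. [folklore] -/
theorem integrable_prod_of_integrable {F : Type*} [NormedAddCommGroup F] [NormedSpace ℝ F]
    {g : E → F} (hg : Integrable g) :
    Integrable (fun p : K × Kᗮ => g ((p.1 : E) + p.2)) ((volume : Measure K).prod volume) := by
  have h := (MeasurePreserving.symm (splitEquiv K) (measurePreserving_splitEquiv K)).integrable_comp_emb
    (splitEquiv K).symm.measurableEmbedding (g := g)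
  have h2 := h.2 hg
  refine h2.congr (ae_of_all _ fun p => ?_)
  simp only [Function.comp_apply, splitEquiv_symm_apply]

variable {K}

omit [MeasurableSpace E] [BorelSpace E] in
/-- `P_K(λ₁ + λ₂) = λ₁` for `λ₁ ∈ K`, `λ₂ ∈ K^⊥`. [folklore] -/
theorem starProjection_add (x : K) (y : Kᗮ) : K.starProjection ((x : E) + y) = x := by
  have hy : K.starProjection (y : E) = 0 := by
    rw [Submodule.starProjection_apply, Submodule.orthogonalProjectionOnto_eq_zero_iff.2 y.2,
      Submodule.coe_zero]
  rw [map_add, Submodule.starProjection_mem_subspace_eq_self, hy, add_zero]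

omit [MeasurableSpace E] [BorelSpace E] in
/-- `P_{K^⊥}(λ₁ + λ₂) = λ₂` for `λ₁ ∈ K`, `λ₂ ∈ K^⊥`. [folklore] -/
theorem orthogonalProjectionOnto_orthogonal_add (x : K) (y : Kᗮ) :
    Kᗮ.orthogonalProjectionOnto ((x : E) + y) = y := by
  rw [map_add, Submodule.orthogonalProjectionOnto_orthogonal_apply_eq_zero x.2,
    Submodule.orthogonalProjectionOnto_mem_subspace_eq_self, zero_add]

/-- `δ_K^α(λ₁ + λ₂) = Z_K(α)⁻¹ γ_α(λ₁)` for `λ₁ ∈ K`, `λ₂ ∈ K^⊥`. [folklore] -/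
theorem nasc_add (α : ℝ) (x : K) (y : Kᗮ) :
    nasc K α ((x : E) + y) = (Zg K α)⁻¹ * gaussW K α x := by
  unfold nasc; rw [starProjection_add]; rfl

/-- first equality of the display («∫dλ δ_R(λ) f(λ) = ∫dλ δ_R(Rλ) f(λ)»): the nascent density depends on
`λ` only through `P_K λ`. [cite: Balaban1984PropagatorsI, p.25] -/
theorem nasc_starProjection (α : ℝ) (v : E) : nasc K α (K.starProjection v) = nasc K α v := by
  unfold nasc
  rw [show K.starProjection (K.starProjection v) = K.starProjection v from
    Submodule.starProjection_eq_self_iff.2 (by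
      rw [Submodule.starProjection_apply]; exact SetLike.coe_mem _)]

/-- `δ_K^α` is continuous. [folklore] -/
theorem continuous_nasc (α : ℝ) : Continuous (nasc K α) := by
  unfold nasc
  exact continuous_const.mul ((continuous_gaussW α).comp K.starProjection.continuous)

/-- `|δ_K^α| ≤ Z_K(α)⁻¹`. [folklore] -/
theorem abs_nasc_le {α : ℝ} (hα : 0 < α) (v : E) : |nasc K α v| ≤ (Zg K α)⁻¹ := by
  unfold nasc
  rw [abs_mul, abs_of_pos (inv_pos.2 (Zg_pos K hα))]
  exact mul_le_of_le_one_right (le_of_lt (inv_pos.2 (Zg_pos K hα))) (abs_gaussW_le_one hα.le _)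

/-- `∫_K δ_K^α = 1`: `δ_K^α` is a probability density on `K`. [folklore] -/
theorem integral_nasc {α : ℝ} (hα : 0 < α) : ∫ x : K, (Zg K α)⁻¹ * gaussW K α x = 1 := by
  rw [integral_const_mul]; exact inv_mul_cancel₀ (Zg_pos K hα).ne'

/-- The inner step of the display («∫_R dλ₁ δ_R(λ₁) f(λ₁ + λ₂) = f(λ₂)»): on `K` the nascent family is
an honest approximate identity — `∫_K Z_K(α)⁻¹ γ_α(λ₁) f(λ₁ + λ₂) dλ₁ → f(λ₂)` as `α → 0⁺`, for `f`
continuous and bounded (scaling `λ₁ = √α u` and dominated convergence).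
[cite: Balaban1984PropagatorsI, (1.41) p.25] -/
theorem tendsto_inner (f : E → ℝ) (hf : Continuous f) {C : ℝ} (hC : ∀ v, |f v| ≤ C) (y : E) :
    Tendsto (fun α => ∫ x : K, (Zg K α)⁻¹ * gaussW K α x * f (x + y)) (𝓝[>] 0) (𝓝 (f y)) := by
  have hZ1 := Zg_pos K one_pos
  -- the scaling `λ₁ = √α u`
  have hscale : ∀ α : ℝ, 0 < α → ∫ x : K, (Zg K α)⁻¹ * gaussW K α x * f (x + y) =
      ∫ u : K, (Zg K 1)⁻¹ * gaussW K 1 u * f (Real.sqrt α • (u : E) + y) := by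
    intro α hα
    have hsd : 0 < Real.sqrt α ^ finrank ℝ K := pow_pos (Real.sqrt_pos.2 hα) _
    have h := Measure.integral_comp_smul (volume : Measure K)
      (fun x : K => (Zg K α)⁻¹ * gaussW K α x * f (x + y)) (Real.sqrt α)
    beta_reduce at h
    rw [abs_inv, abs_of_pos hsd, smul_eq_mul] at h
    have h' : ∫ x : K, (Zg K α)⁻¹ * gaussW K α x * f (x + y) = Real.sqrt α ^ finrank ℝ K *
        ∫ u : K, (Zg K α)⁻¹ * gaussW K α (Real.sqrt α • u) * f (((Real.sqrt α • u : K) : E) + y) := by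
      rw [h, ← mul_assoc, mul_inv_cancel₀ hsd.ne', one_mul]
    rw [h', ← integral_const_mul]
    congr 1; funext u
    rw [gaussW_sqrt_smul hα, Zg_eq_pow_mul_Zg_one K hα, Submodule.coe_smul]
    field_simp
  -- dominated convergence for the rescaled integrals
  have hlim : Tendsto (fun α : ℝ => ∫ u : K, (Zg K 1)⁻¹ * gaussW K 1 u * f (Real.sqrt α • (u : E) + y))
      (𝓝[>] 0) (𝓝 (∫ u : K, (Zg K 1)⁻¹ * gaussW K 1 u * f y)) := by
    refine tendsto_integral_filter_of_dominated_convergence (fun u => (Zg K 1)⁻¹ * gaussW K 1 u * C)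
      ?_ ?_ ?_ ?_
    · refine Eventually.of_forall fun α => Continuous.aestronglyMeasurable ?_
      have hc : Continuous fun u : K => Real.sqrt α • (u : E) + y := by fun_prop
      exact (continuous_const.mul (continuous_gaussW 1)).mul (hf.comp hc)
    · refine Eventually.of_forall fun α => ae_of_all _ fun u => ?_
      have hpos : 0 < (Zg K 1)⁻¹ * gaussW K 1 u := mul_pos (inv_pos.2 hZ1) (gaussW_pos 1 u)
      rw [Real.norm_eq_abs, abs_mul, abs_of_pos hpos]
      exact mul_le_mul_of_nonneg_left (hC _) hpos.le
    · exact ((integrable_gaussW K one_pos).const_mul _).mul_const _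
    · refine ae_of_all _ fun u => ?_
      have hcont : Tendsto (fun α : ℝ => Real.sqrt α • (u : E) + y) (𝓝[>] 0) (𝓝 y) := by
        have h0 : Tendsto (fun α : ℝ => Real.sqrt α • (u : E) + y) (𝓝 0)
            (𝓝 (Real.sqrt 0 • (u : E) + y)) :=
          ((Real.continuous_sqrt.tendsto 0).smul_const (u : E)).add_const y
        rw [Real.sqrt_zero, zero_smul, zero_add] at h0
        exact h0.mono_left nhdsWithin_le_nhds
      exact ((hf.tendsto y).comp hcont).const_mul _
  have hval : ∫ u : K, (Zg K 1)⁻¹ * gaussW K 1 u * f y = f y := by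
    rw [integral_mul_const, integral_nasc one_pos, one_mul]
  rw [hval] at hlim
  refine hlim.congr' ?_
  filter_upwards [self_mem_nhdsWithin] with α hα using (hscale α hα).symm

variable (K) in
/-- (1.41) and the `δ_R` display, COMPUTED: for every continuous compactly supported `f` on `L²(T_η)`,
`∫ δ_K^α(λ) f(λ) dλ → ∫_{K^⊥} f(λ₂) dλ₂` as `α → 0⁺` — the printed chain «∫dλδ_R(λ)f(λ) = ∫dλδ_R(Rλ)f(λ)
= ∫dλ₂ ∫_R dλ₁ δ_R(λ₁) f(λ₁ + λ₂) = ∫dλ₂ f(λ₂)» with the outer variable `λ₂` ranging over the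
ORTHOGONAL COMPLEMENT `R^⊥` (Fubini along `L² = R ⊕ R^⊥`, then `tendsto_inner`, then dominated
convergence on `R^⊥` using the compact support). [cite: Balaban1984PropagatorsI, (1.41) p.25] -/
theorem tendsto_integral_nasc (f : E → ℝ) (hf : Continuous f) (hsupp : HasCompactSupport f) :
    Tendsto (fun α => ∫ v, nasc K α v * f v) (𝓝[>] 0) (𝓝 (∫ y : Kᗮ, f y)) := by
  obtain ⟨C, hC⟩ := hf.bounded_above_of_compact_support hsupp
  have hC' : ∀ v, |f v| ≤ C := fun v => by simpa [Real.norm_eq_abs] using hC v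
  have hfi : Integrable f := hf.integrable_of_hasCompactSupport hsupp
  -- the slices `I(α, λ₂) = ∫_K δ_K^α(λ₁) f(λ₁ + λ₂) dλ₁`
  set I : ℝ → Kᗮ → ℝ := fun α y => ∫ x : K, (Zg K α)⁻¹ * gaussW K α x * f ((x : E) + y) with hI
  -- Step 1 (Fubini): `∫ δ^α f = ∫_{K^⊥} I(α, λ₂) dλ₂`, and measurability of the slices
  have hG : ∀ α : ℝ, 0 < α →
      Integrable (fun p : K × Kᗮ => nasc K α ((p.1 : E) + p.2) * f ((p.1 : E) + p.2))
        ((volume : Measure K).prod volume) := by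
    intro α hα
    refine integrable_prod_of_integrable K (g := fun v => nasc K α v * f v) ?_
    exact hfi.bdd_mul (continuous_nasc α).aestronglyMeasurable
      (ae_of_all _ fun v => by rw [Real.norm_eq_abs]; exact abs_nasc_le hα v)
  have hfub : ∀ α : ℝ, 0 < α → ∫ v, nasc K α v * f v = ∫ y : Kᗮ, I α y := by
    intro α hα
    rw [integral_eq_integral_prod K (fun v => nasc K α v * f v), integral_prod_symm _ (hG α hα)]
    simp only [hI, nasc_add]
  have hImeas : ∀ α : ℝ, 0 < α → AEStronglyMeasurable (I α) volume := by
    intro α hα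
    have := (hG α hα).integral_prod_right
    simp only [nasc_add] at this
    exact this.aestronglyMeasurable
  -- Step 2: the slices vanish off the compact set `P_{K^⊥}(supp f)` and are bounded by `C`
  set S : Set Kᗮ := (fun v : E => Kᗮ.orthogonalProjectionOnto v) '' tsupport f with hS
  have hScpt : IsCompact S := hsupp.image Kᗮ.orthogonalProjectionOnto.continuous
  have hIzero : ∀ α : ℝ, ∀ y : Kᗮ, y ∉ S → I α y = 0 := by
    intro α y hy
    have hzero : ∀ x : K, f ((x : E) + y) = 0 := by
      intro x
      by_contra hne
      apply hy
      refine ⟨(x : E) + y, subset_tsupport f (Function.mem_support.2 hne), ?_⟩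
      exact orthogonalProjectionOnto_orthogonal_add x y
    simp only [hI, hzero, mul_zero, integral_zero]
  have hIbdd : ∀ α : ℝ, 0 < α → ∀ y : Kᗮ, |I α y| ≤ C := by
    intro α hα y
    have hZ := Zg_pos K hα
    calc |I α y| = ‖∫ x : K, (Zg K α)⁻¹ * gaussW K α x * f ((x : E) + y)‖ := by
          rw [Real.norm_eq_abs]
      _ ≤ ∫ x : K, (Zg K α)⁻¹ * gaussW K α x * C := by
          refine norm_integral_le_of_norm_le (((integrable_gaussW K hα).const_mul _).mul_const _)
            (ae_of_all _ fun x => ?_)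
          have hpos : 0 < (Zg K α)⁻¹ * gaussW K α x := mul_pos (inv_pos.2 hZ) (gaussW_pos α x)
          rw [Real.norm_eq_abs, abs_mul, abs_of_pos hpos]
          exact mul_le_mul_of_nonneg_left (hC' _) hpos.le
      _ = C := by rw [integral_mul_const, integral_nasc hα, one_mul]
  -- Step 3: dominated convergence on `K^⊥`
  have hCnn : 0 ≤ C := le_trans (abs_nonneg _) (hC' 0)
  have hdom : Tendsto (fun α => ∫ y : Kᗮ, I α y) (𝓝[>] 0) (𝓝 (∫ y : Kᗮ, f y)) := by
    refine tendsto_integral_filter_of_dominated_convergence (S.indicator fun _ => C) ?_ ?_ ?_ ?_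
    · filter_upwards [self_mem_nhdsWithin] with α hα using hImeas α hα
    · filter_upwards [self_mem_nhdsWithin] with α hα
      refine ae_of_all _ fun y => ?_
      by_cases hy : y ∈ S
      · rw [Set.indicator_of_mem hy, Real.norm_eq_abs]; exact hIbdd α hα y
      · rw [Set.indicator_of_notMem hy, hIzero α y hy, norm_zero]
    · exact (integrable_indicator_iff hScpt.measurableSet).2
        (integrableOn_const (hScpt.measure_lt_top).ne)
    · exact ae_of_all _ fun y => tendsto_inner f hf hC' (y : E)
  refine hdom.congr' ?_
  filter_upwards [self_mem_nhdsWithin] with α hα using (hfub α hα).symm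

variable (K) in
/-- The same limit stated with `δ_K` and the «δ_R(Rλ)» form of the density.
[cite: Balaban1984PropagatorsI, (1.41) p.25] -/
theorem tendsto_integral_nasc' (f : E → ℝ) (hf : Continuous f) (hsupp : HasCompactSupport f) :
    Tendsto (fun α => ∫ v, nasc K α (K.starProjection v) * f v) (𝓝[>] 0) (𝓝 (deltaK K f)) := by
  simp only [nasc_starProjection]; exact tendsto_integral_nasc K f hf hsupp

end Delta

section Limit141

variable {E : Type*} [NormedAddCommGroup E] [InnerProductSpace ℝ E] [FiniteDimensional ℝ E]
  [MeasurableSpace E] [BorelSpace E]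
variable {N : Submodule ℝ E} {Δ : E →ₗ[ℝ] E}

/-- `𝒢_α = |det(Δ↾_{N(Q′_k)})| · δ_R^α`. [cite: Balaban1984PropagatorsI, (1.39)-(1.41) pp.24-25] -/
theorem calG_eq_detN_mul_nasc (h : Set.InjOn Δ N) (α : ℝ) (f : E) :
    calG N Δ α f = detN N Δ * nasc (Rsub N Δ) α f :=
  calG_eq_detN_mul h α f

/-- (1.41): «the density 𝒢_α has a limit as α → 0: 𝒢_α(∂*A) → |det(Δ↾_{N(Q′_k)})| δ_R(∂*A), where δ_R
is a δ-function concentrated at the origin of the sub-space R» — in the sense of distributions on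
`C_c(L²(T_η))`: `∫ 𝒢_α(λ) f(λ) dλ → |det(Δ↾N(Q′_k))| ∫_{R^⊥} f(λ₂) dλ₂`.
[cite: Balaban1984PropagatorsI, (1.41) p.25] -/
theorem tendsto_integral_calG (h : Set.InjOn Δ N) (f : E → ℝ) (hf : Continuous f)
    (hsupp : HasCompactSupport f) :
    Tendsto (fun α => ∫ v, calG N Δ α v * f v) (𝓝[>] 0)
      (𝓝 (detN N Δ * deltaK (Rsub N Δ) f)) := by
  have hlim := (tendsto_integral_nasc (Rsub N Δ) f hf hsupp).const_mul (detN N Δ)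
  refine hlim.congr' (Eventually.of_forall fun α => ?_)
  rw [← integral_const_mul]
  congr 1; funext v
  rw [calG_eq_detN_mul_nasc h, mul_assoc]

end Limit141

/-! ## §7 The torus model: `L²(T_η)` = real scalar functions on the fine torus, `N(Q′_k) = ker Q′_k`,
`Δ = ∂*∂` — and the hypothesis «Δ positive definite on N(Q′_k), thus invertible» DISCHARGED -/

section Torus

open scoped Matrix ComplexConjugate
open Literature.MathematicalPhysics.QuantumFieldTheory.Balaban1983to89.B5Prop11Plancherel (Tor fine)
open Literature.MathematicalPhysics.QuantumFieldTheory.Balaban1983to89.B5Action121 (LapS)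
open Literature.MathematicalPhysics.QuantumFieldTheory.Balaban1983to89.B5Block118 (QsOp)
open Literature.MathematicalPhysics.QuantumFieldTheory.Balaban1983to89.B5RealFields (reM cplx IsReal
  cplx_eq_zero_iff)

variable {d : ℕ} (n : ℕ) [NeZero n] (M : Fin d → ℕ) [hM : ∀ μ, NeZero (M μ)]

/-- `L²(T_η)`: REAL scalar functions on the fine torus `T_η` (index `Tor (fine n M)`), as a
Euclidean space (inner product `Σ_x u(x)v(x)`, Lebesgue measure). [cite: Balaban1984PropagatorsI, p.22] -/
abbrev L2T : Type := EuclideanSpace ℝ (Tor (fine n M))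

/-- `Δ = ∂*∂` — the typed torus Laplacian `LapS (fine n M) c` (a real matrix:
`B5RealFields.isReal_LapS`) acting on real fields. [cite: Balaban1984PropagatorsI, (1.21) p.21] -/
def DeltaT (c : ℝ) : L2T n M →ₗ[ℝ] L2T n M :=
  Matrix.toEuclideanLin (reM (LapS (fine n M) (c : ℂ)))

/-- `N(Q′_k) = {λ : Q′_kλ = 0}` — the kernel of the typed block average `QsOp n M` on real fields.
[cite: Balaban1984PropagatorsI, p.25] -/
def NQ : Submodule ℝ (L2T n M) :=
  LinearMap.ker (Matrix.toEuclideanLin (reM (QsOp n M)) : L2T n M →ₗ[ℝ] EuclideanSpace ℝ (Tor M))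

/-- `λ ∈ N(Q′_k) ⟺ Q′_kλ = 0` (real fields). [cite: Balaban1984PropagatorsI, p.25] -/
theorem mem_NQ (x : L2T n M) : x ∈ NQ n M ↔ reM (QsOp n M) *ᵥ (WithLp.ofLp x) = 0 := by
  rw [NQ, LinearMap.mem_ker, Matrix.toLpLin_apply]
  constructor
  · intro h; simpa using congrArg WithLp.ofLp h
  · intro h; rw [h]; rfl

/-- `DeltaT` acts as the real matrix `re ∘ LapS`. [folklore] -/
theorem ofLp_DeltaT (c : ℝ) (x : L2T n M) :
    WithLp.ofLp (DeltaT n M c x) = reM (LapS (fine n M) (c : ℂ)) *ᵥ WithLp.ofLp x := rfl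

/-- p. 25: «Let us recall also that the operator Δ is positive definite on N(Q′_k), thus invertible,
as it follows from [2]» — DISCHARGED for the typed torus objects: `Q′_kλ = 0 ∧ Δλ = 0 ⟹ λ = 0`
(`Δλ = 0` forces `λ` constant, `B5LaplaceSpectral.LapS_ker_const`; `Q′_k` of a constant is that
constant, `B5Substitution125.QsOp_const`; the block torus is non-empty).
[cite: Balaban1984PropagatorsI, p.25; Sect. C p.22] -/
theorem injOn_torus {c : ℝ} (hc : c ≠ 0) : Set.InjOn (DeltaT n M c) (NQ n M) := by
  rw [injOn_iff]
  intro x hx hΔ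
  set u : Tor (fine n M) → ℝ := WithLp.ofLp x with hu
  have hcC : (c : ℂ) ≠ 0 := by exact_mod_cast hc
  have hcre : conj (c : ℂ) = c := Complex.conj_ofReal c
  have hL : LapS (fine n M) (c : ℂ) *ᵥ cplx u = 0 := by
    rw [← (B5RealFields.isReal_LapS (fine n M) hcre).cplx_mulVec]
    have h0 : reM (LapS (fine n M) (c : ℂ)) *ᵥ u = 0 := by
      rw [hu, ← ofLp_DeltaT, hΔ]; rfl
    rw [h0]; exact (cplx_eq_zero_iff _).2 rfl
  have hconst : ∀ y, cplx u y = cplx u 0 :=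
    B5LaplaceSpectral.LapS_ker_const (fine n M) hcC (cplx u) hL
  have hQ : QsOp n M *ᵥ cplx u = 0 := by
    rw [← (B5RealFields.isReal_QsOp n M).cplx_mulVec, (mem_NQ n M x).1 hx]
    exact (cplx_eq_zero_iff _).2 rfl
  have hfun : cplx u = fun _ => cplx u 0 := funext hconst
  rw [hfun, B5Substitution125.QsOp_const] at hQ
  have h0 : cplx u 0 = 0 := congrFun hQ 0
  have hu0 : u = 0 := by
    rw [← cplx_eq_zero_iff, hfun, h0]; rfl
  have hx' : x = WithLp.toLp 2 u := by rw [hu, WithLp.toLp_ofLp]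
  rw [hx', hu0]; rfl

/-- p. 25 l. 1 on the torus: `∫_{N(Q′_k)} 𝒢_α(∂*A − Δλ) dλ = 1` for real fields, every `α > 0`
(`c = η⁻¹ ≠ 0`). [cite: Balaban1984PropagatorsI, p.25 l.1] -/
theorem integral_calG_sub_Delta_torus {c : ℝ} (hc : c ≠ 0) {α : ℝ} (hα : 0 < α) (f : L2T n M) :
    ∫ x : NQ n M, calG (NQ n M) (DeltaT n M c) α (f - DeltaT n M c x) = 1 :=
  integral_calG_sub_Delta (injOn_torus n M hc) hα f

/-- (1.41) on the torus: `∫ 𝒢_α(λ) f(λ) dλ → |det(Δ↾N(Q′_k))| ∫_{R^⊥} f(λ₂) dλ₂` for `f ∈ C_c(L²(T_η))`.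
[cite: Balaban1984PropagatorsI, (1.41) p.25] -/
theorem tendsto_integral_calG_torus {c : ℝ} (hc : c ≠ 0) (f : L2T n M → ℝ) (hf : Continuous f)
    (hsupp : HasCompactSupport f) :
    Tendsto (fun α => ∫ v, calG (NQ n M) (DeltaT n M c) α v * f v) (𝓝[>] 0)
      (𝓝 (detN (NQ n M) (DeltaT n M c) * deltaK (Rsub (NQ n M) (DeltaT n M c)) f)) :=
  tendsto_integral_calG (injOn_torus n M hc) f hf hsupp

/-- (1.46) on the torus, for an arbitrary regularisation `φ` of `δ_R`:
`∫_{N(Q′_k)} |det(Δ↾N(Q′_k))| φ(R(∂*A − Δλ)) dλ = ∫_R φ`. [cite: Balaban1984PropagatorsI, (1.46) p.26] -/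
theorem integral_146_torus {c : ℝ} (hc : c ≠ 0) (φ : L2T n M → ℝ) (f : L2T n M) :
    ∫ x : NQ n M, detN (NQ n M) (DeltaT n M c) • φ (Rop (NQ n M) (DeltaT n M c) (f - DeltaT n M c x))
      = ∫ y : Rsub (NQ n M) (DeltaT n M c), φ y :=
  integral_146 (injOn_torus n M hc) φ f

end Torus

end Literature.MathematicalPhysics.QuantumFieldTheory.Balaban1983to89.B5GaussSectC

end
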